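import Summits.AtomisticToContinuum.HydrodynamicLimit.Theorems.TwoClocksEquilibriumFastWindowLDBirthT12LogQuadraticB
import Summits.AtomisticToContinuum.HydrodynamicLimit.Theorems.TwoClocksEquilibriumFastWindowLDBirthQuarticPreimage
import Summits.AtomisticToContinuum.HydrodynamicLimit.Theorems.TwoClocksEquilibriumFastWindowLDBirthT12Absorption
import HarnessLib

/-!
# Weighted absorption for Grad's integral equation with the log-quadratic weight, II: the
# Chapman–Enskog pre-image of quadratic data with `2 + log` growth, uniformly in the support radius
# (helper `t12_logQuadraticPreimage_of_quadraticData` of the line `birth`, crux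
# `TwoClocks.EquilibriumFastWindowLD`, stmt-AtomisticToContinuum-14440; infrastructure towards the
# registered analytic sub-goal `t12_logLinearPreimage_and_dipoleModulus`)

Third file of the "`2 + log`" a-priori bound. For continuous data `g` with `|g| ≤ C_g (1 + |v|²)`,
compact velocity support and `g ⊥_M span {1, v, |v|²}`, the `M`-orthogonal pre-image `ψ₀` of `g` under the
linearised hard-sphere operator `L` of `ℝ³` satisfies
**`|ψ₀(v)| ≤ C C_g (1 + |v|²)(1 + log (1 + |v|²))` with `C` ABSOLUTE** (`t12_logQuadraticPreimage_of_quadraticData`),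
one logarithm off the true growth `|v|² ` of the orthogonal inverse
(`Literature.Analysis.UnboundedOperators.LinearizedBoltzmannOrthogonalInverseUnbounded`) and one power
below the tree's / `…BirthQuarticPreimage`'s quartic bound, which is the a-priori INPUT here. Scheme
(Grad 1963 / Caflisch 1980 / Guo 2010, weighted `L^∞`): with `Φ = P (1 + log P)`, `P = 1 + |v|²`, and the
truncated weight `W_N = Φ + P²/N`,
* `m_N := sup |ψ₀|/W_N ≤ C₄ C_g N < ∞` (quartic a-priori bound);
* far field (`|y| ≥ R₀`, `R₀` absolute: `logWeight_far_of_le`, `1 + log (1 + s²) ≤ 6 √s`): the off-ball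
  step `t12_abs_le_logWeight_of_fixedPoint` of `…LogQuadraticB` gives
  `|ψ₀| ≤ m (Φ - P/4 + (3/4) P²/N) + e P`, `e = e₀ (B + C_g) ≲ C_g`; the margin `(P + P²/N)/8` dominates
  `W_N/(16 (1 + log 4N²))` UNIFORMLY IN THE SPEED for each `N` (`logWeight_truncation_margin`: on
  `{1 + log P > P/N}` one has `P < 4N²`), whence the self-improvement
  `|ψ₀| ≤ ((1 - δ_N) m + δ_N E) W_N`, `δ_N = 1/(16 (1 + log 4N²))`, `E ≍ C_g` independent of `N`
  (`le_selfImproving_of_margin`, `abs_le_selfImproving_logWeight`);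
* near field: the `L²(M)`-based ball bound `abs_le_of_fixedPoint_of_norm_lt` of `…BirthQuarticPreimage`;
* `t12_abs_le_weight_of_selfImproving` (`…BirthT12Absorption`) with `μ = 1 - δ_N`, `D = δ_N E`:
  `|ψ₀| ≤ E W_N` for every `N ≥ 1` — the `N`-dependence of the contraction rate cancels against that
  of `D` — and `N → ∞` (`le_mul_of_forall_le_mul_add_div`).

This is the bound "`W = (1 + |v|²) log (2 + |v|²)` is a strict supersolution with margin `≍ 1/log`"
of the plan (`t12_corrector_analysis.md` §3) made quantitative; it is the sharpest growth a POSITIVITY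
scheme can certify (the critical power carries the energy resonance `λ₀(2) = 1`), the log-linear truth
requiring the sector analysis of the sub-goal. References: Grad 1963 §4; Caflisch, CMP 74 (1980) §2;
Guo, ARMA 197 (2010) §3; CIP 1994 §7.2. Tagged folklore (elementary given files I–II and the tree).
-/

noncomputable section

open MeasureTheory ProbabilityTheory Real Set Filter Metric
open scoped ENNReal BigOperators InnerProductSpace

namespace Summit.AtomisticToContinuum.HydrodynamicLimit.Theorems.ClampedCorrectorBirth

open Literature.Analysis.FluidPDE Literature.MathematicalPhysics.KineticTheory
open Literature.Analysis.UnboundedOperators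

/-! ### Real-variable lemmas: the far-field radius and the uniform margin of the truncated weight -/

/-- `1 + log (1 + s²) ≤ 6 √s` for `s ≥ 1` (`log x ≤ x - 1` at `x = √(2s)`). [folklore] -/
theorem one_add_log_one_add_sq_le {s : ℝ} (hs : 1 ≤ s) : 1 + Real.log (1 + s ^ 2) ≤ 6 * Real.sqrt s := by
  have hs0 : 0 < s := by linarith
  have h1 : Real.log (1 + s ^ 2) ≤ Real.log ((2 * s) ^ 2) := Real.log_le_log (by positivity) (by nlinarith)
  have h2 : Real.log ((2 * s) ^ 2) = 4 * Real.log (Real.sqrt (2 * s)) := by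
    rw [Real.log_pow, Real.log_sqrt (by positivity)]; push_cast; ring
  have h3 : Real.log (Real.sqrt (2 * s)) ≤ Real.sqrt (2 * s) - 1 :=
    Real.log_le_sub_one_of_pos (Real.sqrt_pos.2 (by positivity))
  have h4 : Real.sqrt (2 * s) ≤ 3 / 2 * Real.sqrt s := by
    rw [Real.sqrt_mul (by norm_num : (0:ℝ) ≤ 2)]
    refine mul_le_mul_of_nonneg_right ?_ (Real.sqrt_nonneg _)
    rw [show (3 / 2 : ℝ) = Real.sqrt ((3 / 2) ^ 2) by rw [Real.sqrt_sq (by norm_num)]]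
    exact Real.sqrt_le_sqrt (by norm_num)
  linarith [Real.sqrt_nonneg s]

/-- The far-field condition of `t12_gain_logWeight_margin` holds beyond an explicit radius: for `K ≥ 0`
and `s ≥ 576 (1 + K)²`, `(1 + log (1 + s²))(1/s² + K/s) ≤ 1/4`. [folklore] -/
theorem logWeight_far_of_le {K s : ℝ} (hK : 0 ≤ K) (hs : 576 * (1 + K) ^ 2 ≤ s) :
    (1 + Real.log (1 + s ^ 2)) * (1 / s ^ 2 + K / s) ≤ 1 / 4 := by
  have hs1 : 1 ≤ s := by nlinarith
  have hs0 : 0 < s := by linarith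
  set r : ℝ := Real.sqrt s with hr
  have hr0 : 0 < r := Real.sqrt_pos.2 hs0
  have hrs : r ^ 2 = s := Real.sq_sqrt hs0.le
  have hr24 : 24 * (1 + K) ≤ r := by
    rw [hr, show 24 * (1 + K) = Real.sqrt ((24 * (1 + K)) ^ 2) by rw [Real.sqrt_sq (by positivity)]]
    exact Real.sqrt_le_sqrt (by nlinarith)
  have hL := one_add_log_one_add_sq_le hs1
  rw [← hr] at hL
  have hL0 : 0 ≤ 1 + Real.log (1 + s ^ 2) := by linarith [Real.log_nonneg (by nlinarith : (1:ℝ) ≤ 1 + s ^ 2)]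
  have h1 : 1 / s ^ 2 + K / s ≤ (1 + K) / s := by
    rw [add_div, add_le_add_iff_right, div_le_div_iff₀ (by positivity) hs0]; nlinarith
  calc (1 + Real.log (1 + s ^ 2)) * (1 / s ^ 2 + K / s) ≤ (6 * r) * ((1 + K) / s) :=
        mul_le_mul hL h1 (by positivity) (by positivity)
    _ = 6 * (1 + K) / r := by rw [← hrs]; field_simp
    _ ≤ 1 / 4 := by rw [div_le_iff₀ hr0]; linarith

/-- **The margin of the truncated log-quadratic weight is uniform in the speed for each truncation
level.** For `N ≥ 1`, `P ≥ 1`: `P (1 + log P) + P²/N ≤ 2 (1 + log (4N²)) (P + P²/N)`, i.e. with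
`W_N = Φ + P²/N` and the margin `(P + P²/N)/8` of the absorption step,
`W_N/(16 (1 + log (4N²))) ≤ (P + P²/N)/8`: on `{1 + log P ≤ P/N}` the quartic part dominates, on its
complement `P < N (1 + log P) < 2N √P` forces `P < 4N²`. [folklore] -/
theorem logWeight_truncation_margin {N P : ℝ} (hN : 1 ≤ N) (hP : 1 ≤ P) :
    P * (1 + Real.log P) + P ^ 2 / N ≤ 2 * (1 + Real.log (4 * N ^ 2)) * (P + P ^ 2 / N) := by
  have hP0 : 0 < P := by linarith
  have hN0 : 0 < N := by linarith
  have hLN : 1 ≤ 1 + Real.log (4 * N ^ 2) := by linarith [Real.log_nonneg (by nlinarith : (1:ℝ) ≤ 4 * N ^ 2)]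
  have hlP0 : 0 ≤ Real.log P := Real.log_nonneg hP
  have hPN : 0 ≤ P ^ 2 / N := by positivity
  rcases le_or_gt (1 + Real.log P) (P / N) with hc | hc
  · -- the quartic part dominates
    have h1 : P * (1 + Real.log P) ≤ P ^ 2 / N := by
      calc P * (1 + Real.log P) ≤ P * (P / N) := mul_le_mul_of_nonneg_left hc hP0.le
        _ = P ^ 2 / N := by ring
    nlinarith
  · -- `P < 4 N²`
    have hsq : Real.log P ≤ 2 * (Real.sqrt P - 1) := by
      have h := Real.log_le_sub_one_of_pos (Real.sqrt_pos.2 hP0)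
      rw [Real.log_sqrt hP0.le] at h
      linarith
    have hr : P = Real.sqrt P * Real.sqrt P := (Real.mul_self_sqrt hP0.le).symm
    have h4 : P < 4 * N ^ 2 := by
      have h1 : P / N < 2 * Real.sqrt P := by linarith
      rw [div_lt_iff₀ hN0] at h1
      have h2 : Real.sqrt P < 2 * N := by
        by_contra h
        push Not at h
        nlinarith [Real.sqrt_nonneg P, h, h1, hr]
      nlinarith [Real.sqrt_nonneg P]
    have hL : 1 + Real.log P ≤ 1 + Real.log (4 * N ^ 2) := by
      linarith [Real.log_le_log hP0 h4.le]
    calc P * (1 + Real.log P) + P ^ 2 / N ≤ P * (1 + Real.log (4 * N ^ 2)) + P ^ 2 / N * (1 + Real.log (4 * N ^ 2)) := by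
          nlinarith [mul_le_mul_of_nonneg_left hL hP0.le, le_mul_of_one_le_right hPN hLN]
      _ ≤ 2 * (1 + Real.log (4 * N ^ 2)) * (P + P ^ 2 / N) := by nlinarith

/-- **Self-improvement algebra.** If `t ≤ m (Φ - P/4 + (3/4) Q) + e P` (the off-ball step, `Q = P²/N`),
`t ≤ m (Φ + Q)` (the domination itself), `m, e, P, Q, Φ, δ ≥ 0` and `δ (Φ + Q) ≤ (P + Q)/8`, then
`t ≤ ((1 - δ) m + δ (8 e)) (Φ + Q)`: for `m ≤ 8e` the domination suffices, for `m > 8e` the data term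
`e P ≤ m P/8` is absorbed by the margin `m P/4`. [folklore] -/
theorem le_selfImproving_of_margin {t m e P Q Φ δ : ℝ} (hm : 0 ≤ m) (he : 0 ≤ e) (hP : 0 ≤ P) (hQ : 0 ≤ Q)
    (hΦ : 0 ≤ Φ) (hδ0 : 0 ≤ δ) (hδ : δ * (Φ + Q) ≤ (P + Q) / 8)
    (hdom : t ≤ m * (Φ + Q)) (hstep : t ≤ m * (Φ - P / 4 + 3 / 4 * Q) + e * P) :
    t ≤ ((1 - δ) * m + δ * (8 * e)) * (Φ + Q) := by
  rcases le_or_gt m (8 * e) with hme | hme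
  · have : 0 ≤ δ * (8 * e - m) * (Φ + Q) := mul_nonneg (mul_nonneg hδ0 (by linarith)) (by linarith)
    nlinarith
  · have h1 : (m - 8 * e) * (δ * (Φ + Q)) ≤ (m - 8 * e) * ((P + Q) / 8) :=
      mul_le_mul_of_nonneg_left hδ (by linarith)
    nlinarith [mul_nonneg hm hP, mul_nonneg hm hQ, mul_nonneg he hP]

/-! ### The far-field self-improvement -/

/-- **Far-field self-improvement of the truncated log-quadratic domination.** Under the hypotheses of
`t12_abs_le_logWeight_of_fixedPoint` with `N ≥ 1` and the far-field radius conditions `|y| ≥ 4`,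
`π|y| ≥ 144 σ(S²) m₅`, `|y| ≥ 576 (1 + 2σ(S²)m₅/π)²`, the domination `|ψ| ≤ m W_N` improves at `y` to
`|ψ(y)| ≤ ((1 - δ_N) m + δ_N · 8e) W_N(y)`, `δ_N = 1/(16 (1 + log 4N²))`, `e = e₀ (B + C_g)`: the off-ball
step, `le_selfImproving_of_margin` and the uniform margin `logWeight_truncation_margin`. [folklore] -/
theorem abs_le_selfImproving_logWeight {ψ g : EuclideanSpace ℝ (Fin 3) → ℝ} (hψm : Measurable ψ)
    (hψ2 : MemLp ψ 2 (stdGaussian (EuclideanSpace ℝ (Fin 3)))) {N m B Cg ν₀ : ℝ}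
    (hN : 1 ≤ N) (hm : 0 ≤ m) (hB0 : 0 ≤ B) (hCg : 0 ≤ Cg) (hν₀ : 0 < ν₀)
    (hdom : ∀ x, |ψ x| ≤ m * ((1 + ‖x‖ ^ 2) * (1 + Real.log (1 + ‖x‖ ^ 2)) + (1 + ‖x‖ ^ 2) ^ 2 / N))
    (hB : (eLpNorm ψ 2 (stdGaussian (EuclideanSpace ℝ (Fin 3)))).toReal ≤ B)
    {y : EuclideanSpace ℝ (Fin 3)} (hy1 : 4 ≤ ‖y‖)
    (hy2 : 144 * ((sphereMeasure : Measure (sphere (0 : EuclideanSpace ℝ (Fin 3)) 1)).real univ *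
      (∫ w, (1 + ‖w‖) ^ 5 ∂stdGaussian (EuclideanSpace ℝ (Fin 3)))) ≤ Real.pi * ‖y‖)
    (hy3 : 576 * (1 + 2 * ((sphereMeasure : Measure (sphere (0 : EuclideanSpace ℝ (Fin 3)) 1)).real univ *
      ∫ w, (1 + ‖w‖) ^ 5 ∂stdGaussian (EuclideanSpace ℝ (Fin 3))) / Real.pi) ^ 2 ≤ ‖y‖)
    (hνy : ν₀ ≤ collisionFrequency y) (hgb : |g y| ≤ Cg * (1 + ‖y‖ ^ 2))
    (hfix : collisionFrequency y * ψ y =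
      (∫ w, ∫ ω, hardSphereKernel (y, w) ω * (ψ (collide ω (y, w)).1 + ψ (collide ω (y, w)).2 - ψ w)
        ∂sphereMeasure ∂stdGaussian (EuclideanSpace ℝ (Fin 3))) - g y) :
    |ψ y| ≤ ((1 - 1 / (16 * (1 + Real.log (4 * N ^ 2)))) * m + 1 / (16 * (1 + Real.log (4 * N ^ 2))) *
        (8 * ((((sphereMeasure : Measure (sphere (0 : EuclideanSpace ℝ (Fin 3)) 1)).real univ *
          ((∫⁻ w, ENNReal.ofReal ((1 + ‖w‖) ^ 2) ∂stdGaussian (EuclideanSpace ℝ (Fin 3))) ^ (1 / 2 : ℝ)).toReal) *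
            (1 / ν₀ + 1 / Real.pi) + 1 / Real.pi) * (B + Cg)))) *
      ((1 + ‖y‖ ^ 2) * (1 + Real.log (1 + ‖y‖ ^ 2)) + (1 + ‖y‖ ^ 2) ^ 2 / N) := by
  set K : ℝ := 2 * ((sphereMeasure : Measure (sphere (0 : EuclideanSpace ℝ (Fin 3)) 1)).real univ *
      ∫ w, (1 + ‖w‖) ^ 5 ∂stdGaussian (EuclideanSpace ℝ (Fin 3))) / Real.pi with hK
  have hK0 : 0 ≤ K := div_nonneg (mul_nonneg two_pos.le (mul_nonneg measureReal_nonneg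
    (integral_nonneg fun w => by positivity))) Real.pi_pos.le
  have hyn : 0 < ‖y‖ := by linarith
  have hfar : (1 + Real.log (1 + ‖y‖ ^ 2)) * (1 / ‖y‖ ^ 2 +
      2 * ((sphereMeasure : Measure (sphere (0 : EuclideanSpace ℝ (Fin 3)) 1)).real univ *
        ∫ w, (1 + ‖w‖) ^ 5 ∂stdGaussian (EuclideanSpace ℝ (Fin 3))) / (Real.pi * ‖y‖)) ≤ 1 / 4 := by
    have h := logWeight_far_of_le hK0 hy3
    rw [hK, div_div] at h
    exact h
  have hstep := t12_abs_le_logWeight_of_fixedPoint ψ g N m B Cg ν₀ y hψm hψ2 (by linarith) hm hB0 hCg hν₀ hdom hB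
    hy1 hy2 hfar hνy hgb hfix
  set e : ℝ := (((sphereMeasure : Measure (sphere (0 : EuclideanSpace ℝ (Fin 3)) 1)).real univ *
    ((∫⁻ w, ENNReal.ofReal ((1 + ‖w‖) ^ 2) ∂stdGaussian (EuclideanSpace ℝ (Fin 3))) ^ (1 / 2 : ℝ)).toReal) *
      (1 / ν₀ + 1 / Real.pi) + 1 / Real.pi) * (B + Cg) with he
  have he0 : 0 ≤ e := mul_nonneg (add_nonneg (mul_nonneg (mul_nonneg measureReal_nonneg ENNReal.toReal_nonneg)
    (by positivity)) (by positivity)) (add_nonneg hB0 hCg)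
  set P : ℝ := 1 + ‖y‖ ^ 2 with hP
  have hP1 : 1 ≤ P := by rw [hP]; nlinarith
  have hLN : 1 ≤ 1 + Real.log (4 * N ^ 2) := by linarith [Real.log_nonneg (by nlinarith : (1:ℝ) ≤ 4 * N ^ 2)]
  refine le_selfImproving_of_margin hm he0 (by linarith) (by positivity)
    (mul_nonneg (by linarith) (by linarith [Real.log_nonneg hP1])) (by positivity) ?_ (hdom y) hstep
  have h := logWeight_truncation_margin hN hP1
  rw [div_mul_eq_mul_div, one_mul, div_le_div_iff₀ (by positivity) (by norm_num)]
  linarith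

/-! ### The Chapman–Enskog pre-image of quadratic data with `2 + log` growth -/

/-- `L²(M)` domination: `|ψ| ≤ A W` with `W ∈ L²(M)` gives `‖ψ‖_{L²(M)} ≤ A ‖W‖_{L²(M)}`. [folklore] -/
theorem eLpNorm_toReal_le_of_abs_le_mul {ψ W : EuclideanSpace ℝ (Fin 3) → ℝ} {A : ℝ} (hA : 0 ≤ A)
    (hW : MemLp W 2 (stdGaussian (EuclideanSpace ℝ (Fin 3)))) (h : ∀ v, |ψ v| ≤ A * W v) :
    (eLpNorm ψ 2 (stdGaussian (EuclideanSpace ℝ (Fin 3)))).toReal ≤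
      A * (eLpNorm W 2 (stdGaussian (EuclideanSpace ℝ (Fin 3)))).toReal := by
  have h1 : eLpNorm ψ 2 (stdGaussian (EuclideanSpace ℝ (Fin 3))) ≤
      eLpNorm (A • W) 2 (stdGaussian (EuclideanSpace ℝ (Fin 3))) :=
    eLpNorm_mono_real fun v => by
      rw [Real.norm_eq_abs, Pi.smul_apply, smul_eq_mul]
      exact h v
  rw [eLpNorm_const_smul, Real.enorm_eq_ofReal hA] at h1
  have h2 := ENNReal.toReal_mono (ENNReal.mul_ne_top ENNReal.ofReal_ne_top hW.eLpNorm_ne_top) h1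
  rwa [ENNReal.toReal_mul, ENNReal.toReal_ofReal hA] at h2

/-- The quartic weight `(1 + |·|²)²` is in `L²(M dv)` (Gaussian eighth moment). [folklore] -/
theorem memLp_two_quarticWeight :
    MemLp (fun v : EuclideanSpace ℝ (Fin 3) => (1 + ‖v‖ ^ 2) ^ 2) 2 (stdGaussian (EuclideanSpace ℝ (Fin 3))) := by
  have hmeas : AEStronglyMeasurable (fun v : EuclideanSpace ℝ (Fin 3) => (1 + ‖v‖ ^ 2) ^ 2)
      (stdGaussian (EuclideanSpace ℝ (Fin 3))) := by fun_prop
  rw [memLp_two_iff_integrable_sq hmeas]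
  refine (integrable_one_add_norm_pow_stdGaussian (E := EuclideanSpace ℝ (Fin 3)) 8).mono' (by fun_prop)
    (Eventually.of_forall fun v => ?_)
  rw [Real.norm_of_nonneg (sq_nonneg _)]
  have h : 1 + ‖v‖ ^ 2 ≤ (1 + ‖v‖) ^ 2 := by nlinarith [norm_nonneg v]
  calc ((1 + ‖v‖ ^ 2) ^ 2) ^ 2 = (1 + ‖v‖ ^ 2) ^ 4 := by ring
    _ ≤ ((1 + ‖v‖) ^ 2) ^ 4 := pow_le_pow_left₀ (by positivity) h 4
    _ = (1 + ‖v‖) ^ 8 := by ring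

/-- `(1 + |x|²)² ≤ 32 e^{|x|²/4}` (`1 + u + u²/2 ≤ e^u` at `u = |x|²/4`). [folklore] -/
theorem quarticWeight_le_exp (x : EuclideanSpace ℝ (Fin 3)) : (1 + ‖x‖ ^ 2) ^ 2 ≤ 32 * Real.exp (‖x‖ ^ 2 / 4) := by
  have h := Real.quadratic_le_exp_of_nonneg (by positivity : (0:ℝ) ≤ ‖x‖ ^ 2 / 4)
  nlinarith [sq_nonneg (‖x‖ ^ 2)]

/-- **Registered helper `t12_logQuadraticPreimage_of_quadraticData` — the Chapman–Enskog pre-image of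
quadratic data with `2 + log` growth, uniformly in the support radius (`ℝ³`).** There is an ABSOLUTE
constant `C > 0` such that for every continuous `g` with `|g(v)| ≤ C_g (1 + |v|²)`, supported in a ball
`{|v| < R}` and `M`-orthogonal to the collision invariants `span {1, v, |v|²}`, the `M`-orthogonal pre-image
`ψ₀` under the linearised hard-sphere operator (`L ψ₀ = g` at every point; continuous; `ψ₀ ∈ L²(M dv)`;
`ψ₀ ⊥_M` the invariants) satisfies **`|ψ₀(v)| ≤ C · C_g · (1 + |v|²)(1 + log (1 + |v|²))` for all `v`**,
`C` independent of `g`, `C_g`, `R`. Proof: `ψ₀` and its `R`-uniform quartic bound from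
`t12_quarticPreimage_of_quadraticData`; Grad's integral equation
(`hardSphereLinearizedOp_eq_kernel_sub_of_gaussGrowth`); `‖ψ₀‖_{L²(M)} ≤ C₄ C_g ‖(1 + |·|²)²‖_{L²(M)}`; for
each `N ≥ 1` the `sSup` absorption `t12_abs_le_weight_of_selfImproving` for `W_N = Φ + P²/N` with
`μ = 1 - δ_N`, `D = δ_N E C_g` (ball: `abs_le_of_fixedPoint_of_norm_lt`; far field:
`abs_le_selfImproving_logWeight`), giving `|ψ₀| ≤ E C_g W_N` uniformly in `N`; `N → ∞`. -/
theorem t12_logQuadraticPreimage_of_quadraticData : ∃ C : ℝ, 0 < C ∧ ∀ (g : EuclideanSpace ℝ (Fin 3) → ℝ) (Cg R : ℝ), Continuous g → (∀ v, |g v| ≤ Cg * (1 + ‖v‖ ^ 2)) → (∀ v, R ≤ ‖v‖ → g v = 0) → (∀ φ ∈ Literature.Analysis.UnboundedOperators.collisionInvariants (EuclideanSpace ℝ (Fin 3)), Literature.Analysis.UnboundedOperators.maxwellianInner g φ = 0) → ∃ ψ₀ : EuclideanSpace ℝ (Fin 3) → ℝ, Continuous ψ₀ ∧ (∀ v, |ψ₀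 v| ≤ C * Cg * (1 + ‖v‖ ^ 2) * (1 + Real.log (1 + ‖v‖ ^ 2))) ∧ MeasureTheory.MemLp ψ₀ 2 (ProbabilityTheory.stdGaussian (EuclideanSpace ℝ (Fin 3))) ∧ (∀ φ ∈ Literature.Analysis.UnboundedOperators.collisionInvariants (EuclideanSpace ℝ (Fin 3)), Literature.Analysis.UnboundedOperators.maxwellianInner ψ₀ φ = 0) ∧ ∀ v, Literature.Analysis.UnboundedOperators.hardSphereLinearizedOp ψ₀ v = g v := by
  obtain ⟨C4, hC4, hquart⟩ := t12_quarticPreimage_of_quadraticData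
  obtain ⟨ν₀, hν₀, hν₀le⟩ := exists_pos_le_collisionFrequency (E := EuclideanSpace ℝ (Fin 3)) (by simp)
  obtain ⟨Kx, hKx0, hKx⟩ := exists_abs_kernelAction_le_exp
  -- the absolute constants (kept opaque)
  obtain ⟨S, hS⟩ : ∃ S : ℝ, S = (sphereMeasure : Measure (sphere (0 : EuclideanSpace ℝ (Fin 3)) 1)).real univ :=
    ⟨_, rfl⟩
  have hS0 : 0 ≤ S := by rw [hS]; exact measureReal_nonneg
  obtain ⟨m₅, hm₅⟩ : ∃ m₅ : ℝ, m₅ = ∫ w, (1 + ‖w‖) ^ 5 ∂stdGaussian (EuclideanSpace ℝ (Fin 3)) := ⟨_, rfl⟩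
  have hm₅0 : 0 ≤ m₅ := by rw [hm₅]; exact integral_nonneg fun w => by positivity
  obtain ⟨m₂, hm₂⟩ : ∃ m₂ : ℝ, m₂ = (((∫⁻ w, ENNReal.ofReal ((1 + ‖w‖) ^ 2)
    ∂stdGaussian (EuclideanSpace ℝ (Fin 3))) ^ (1 / 2 : ℝ))).toReal := ⟨_, rfl⟩
  have hm₂0 : 0 ≤ m₂ := by rw [hm₂]; exact ENNReal.toReal_nonneg
  obtain ⟨M8, hM8⟩ : ∃ M8 : ℝ, M8 = (eLpNorm (fun v : EuclideanSpace ℝ (Fin 3) => (1 + ‖v‖ ^ 2) ^ 2) 2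
    (stdGaussian (EuclideanSpace ℝ (Fin 3)))).toReal := ⟨_, rfl⟩
  have hM80 : 0 ≤ M8 := by rw [hM8]; exact ENNReal.toReal_nonneg
  have hπ := Real.pi_pos
  set K : ℝ := 2 * (S * m₅) / Real.pi with hK
  have hK0 : 0 ≤ K := by positivity
  set R₀ : ℝ := 576 * (1 + K) ^ 2 + 144 * (S * m₅) / Real.pi + 4 with hR₀
  have hq1 : 0 ≤ 576 * (1 + K) ^ 2 := by positivity
  have hq2 : 0 ≤ 144 * (S * m₅) / Real.pi := by positivity
  set e₀ : ℝ := S * m₂ * (1 / ν₀ + 1 / Real.pi) + 1 / Real.pi with he₀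
  have he₀0 : 0 ≤ e₀ := by positivity
  set Dc : ℝ := (Kx * (C4 * M8) * Real.exp (R₀ ^ 2 / 4) + (1 + R₀ ^ 2)) / ν₀ with hDc
  have hDc0 : 0 < Dc := by positivity
  set Ec : ℝ := max (8 * (e₀ * (C4 * M8 + 1))) Dc with hEc
  have hEc0 : 0 < Ec := hDc0.trans_le (le_max_right _ _)
  clear_value K R₀ e₀ Dc Ec
  refine ⟨Ec, hEc0, fun g Cg R hg hgb hsupp horth => ?_⟩
  have hCg0 : 0 ≤ Cg := by
    have h := hgb 0
    rw [norm_zero] at h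
    norm_num at h
    exact (abs_nonneg _).trans h
  obtain ⟨ψ₀, hcont, hq, hmem, horth', hL⟩ := hquart g Cg R hg hgb hsupp horth
  refine ⟨ψ₀, hcont, ?_, hmem, horth', hL⟩
  have hψm : Measurable ψ₀ := hcont.measurable
  -- Gaussian growth, Grad's integral equation, the `L²` bound
  have hgrowth : ∀ x, |ψ₀ x| ≤ 32 * C4 * Cg * Real.exp (‖x‖ ^ 2 / 4) := fun x =>
    (hq x).trans (by nlinarith [quarticWeight_le_exp x, mul_nonneg hC4.le hCg0])
  have hfix : ∀ v, collisionFrequency v * ψ₀ v =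
      (∫ w, ∫ ω, hardSphereKernel (v, w) ω * (ψ₀ (collide ω (v, w)).1 + ψ₀ (collide ω (v, w)).2 - ψ₀ w)
        ∂sphereMeasure ∂stdGaussian (EuclideanSpace ℝ (Fin 3))) - g v := by
    intro v
    have h := hardSphereLinearizedOp_eq_kernel_sub_of_gaussGrowth hψm hgrowth v
    rw [hL v] at h
    linarith
  have hB0 : 0 ≤ C4 * M8 * Cg := mul_nonneg (mul_nonneg hC4.le hM80) hCg0
  have hB : (eLpNorm ψ₀ 2 (stdGaussian (EuclideanSpace ℝ (Fin 3)))).toReal ≤ C4 * M8 * Cg := by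
    have h := eLpNorm_toReal_le_of_abs_le_mul (mul_nonneg hC4.le hCg0) memLp_two_quarticWeight hq
    rw [← hM8] at h
    linarith
  -- the ball
  have hball : ∀ y, ‖y‖ < R₀ → |ψ₀ y| ≤ Dc * Cg := by
    intro y hy
    have h := abs_le_of_fixedPoint_of_norm_lt hKx0 hB0 hCg0 hν₀ (hν₀le y) hy hB (hgb y) (hKx ψ₀ hψm hmem y) (hfix y)
    refine h.trans (le_of_eq ?_)
    rw [hDc]
    field_simp
  -- the estimate with the truncated weight, uniformly in `N`
  have key : ∀ N : ℝ, 1 ≤ N → ∀ x,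
      |ψ₀ x| ≤ Ec * Cg * ((1 + ‖x‖ ^ 2) * (1 + Real.log (1 + ‖x‖ ^ 2)) + (1 + ‖x‖ ^ 2) ^ 2 / N) := by
    intro N hN
    have hN0 : 0 < N := by linarith
    have hLN : 1 ≤ 1 + Real.log (4 * N ^ 2) := by linarith [Real.log_nonneg (by nlinarith : (1:ℝ) ≤ 4 * N ^ 2)]
    obtain ⟨δ, hδ⟩ : ∃ δ : ℝ, δ = 1 / (16 * (1 + Real.log (4 * N ^ 2))) := ⟨_, rfl⟩
    have hδ0 : 0 < δ := by rw [hδ]; positivity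
    have hδ1 : δ ≤ 1 := by rw [hδ, div_le_one (by positivity)]; linarith
    obtain ⟨W, hW⟩ : ∃ W : EuclideanSpace ℝ (Fin 3) → ℝ, W = fun x =>
      (1 + ‖x‖ ^ 2) * (1 + Real.log (1 + ‖x‖ ^ 2)) + (1 + ‖x‖ ^ 2) ^ 2 / N := ⟨_, rfl⟩
    have hΦ0 : ∀ x : EuclideanSpace ℝ (Fin 3), 1 ≤ (1 + ‖x‖ ^ 2) * (1 + Real.log (1 + ‖x‖ ^ 2)) := by
      intro x
      have hP1 : 1 ≤ 1 + ‖x‖ ^ 2 := by nlinarith [norm_nonneg x]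
      nlinarith [Real.log_nonneg hP1]
    have hW0 : ∀ x : EuclideanSpace ℝ (Fin 3),
        1 ≤ (1 + ‖x‖ ^ 2) * (1 + Real.log (1 + ‖x‖ ^ 2)) + (1 + ‖x‖ ^ 2) ^ 2 / N := fun x =>
      (hΦ0 x).trans (le_add_of_nonneg_right (by positivity))
    have hW1 : ∀ x, 1 ≤ W x := fun x => by rw [hW]; exact hW0 x
    have hWpos : ∀ x, 0 < W x := fun x => one_pos.trans_le (hW1 x)
    obtain ⟨E, hE⟩ : ∃ E : ℝ, E = Ec * Cg := ⟨_, rfl⟩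
    have hE0 : 0 ≤ E := by rw [hE]; exact mul_nonneg hEc0.le hCg0
    have h := t12_abs_le_weight_of_selfImproving ψ₀ W (1 - δ) (δ * E) (C4 * Cg * N) (by linarith) hWpos ?_ ?_
    · intro x
      have := h x
      rw [sub_sub_cancel, mul_comm δ E, mul_div_assoc, div_self hδ0.ne', mul_one, hW, hE] at this
      exact this
    · -- a-priori: the quartic bound is part of the weight
      intro x
      rw [hW]
      calc |ψ₀ x| ≤ C4 * Cg * (1 + ‖x‖ ^ 2) ^ 2 := hq x
        _ = C4 * Cg * N * ((1 + ‖x‖ ^ 2) ^ 2 / N) := by field_simp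
        _ ≤ C4 * Cg * N * ((1 + ‖x‖ ^ 2) * (1 + Real.log (1 + ‖x‖ ^ 2)) + (1 + ‖x‖ ^ 2) ^ 2 / N) :=
            mul_le_mul_of_nonneg_left (le_add_of_nonneg_left (by linarith [hΦ0 x]))
              (mul_nonneg (mul_nonneg hC4.le hCg0) hN0.le)
    · -- self-improvement
      intro m hm hdom x
      rcases le_or_gt m E with hmE | hEm
      · calc |ψ₀ x| ≤ m * W x := hdom x
          _ ≤ ((1 - δ) * m + δ * E) * W x := by
              refine mul_le_mul_of_nonneg_right ?_ (hWpos x).le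
              linarith [mul_nonneg hδ0.le (sub_nonneg.2 hmE)]
      · have hconv : E ≤ (1 - δ) * m + δ * E := by
          linarith [mul_nonneg (sub_nonneg.2 hδ1) (sub_nonneg.2 hEm.le)]
        rcases lt_or_ge ‖x‖ R₀ with hx | hx
        · calc |ψ₀ x| ≤ Dc * Cg := hball x hx
            _ ≤ E := by rw [hE]; exact mul_le_mul_of_nonneg_right (by rw [hEc]; exact le_max_right _ _) hCg0
            _ ≤ ((1 - δ) * m + δ * E) * 1 := by rw [mul_one]; exact hconv
            _ ≤ ((1 - δ) * m + δ * E) * W x := mul_le_mul_of_nonneg_left (hW1 x) (by linarith)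
        · have hx1 : 4 ≤ ‖x‖ := by rw [hR₀] at hx; linarith
          have hx2 : 144 * ((sphereMeasure : Measure (sphere (0 : EuclideanSpace ℝ (Fin 3)) 1)).real univ *
              ∫ w, (1 + ‖w‖) ^ 5 ∂stdGaussian (EuclideanSpace ℝ (Fin 3))) ≤ Real.pi * ‖x‖ := by
            rw [← hS, ← hm₅]
            have : 144 * (S * m₅) / Real.pi ≤ ‖x‖ := by rw [hR₀] at hx; linarith
            rwa [div_le_iff₀' Real.pi_pos] at this
          have hx3 : 576 * (1 + 2 * ((sphereMeasure : Measure (sphere (0 : EuclideanSpace ℝ (Fin 3)) 1)).real univ *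
              ∫ w, (1 + ‖w‖) ^ 5 ∂stdGaussian (EuclideanSpace ℝ (Fin 3))) / Real.pi) ^ 2 ≤ ‖x‖ := by
            rw [← hS, ← hm₅, ← hK]; rw [hR₀] at hx; linarith
          have hdom' : ∀ z, |ψ₀ z| ≤ m * ((1 + ‖z‖ ^ 2) * (1 + Real.log (1 + ‖z‖ ^ 2)) + (1 + ‖z‖ ^ 2) ^ 2 / N) := by
            intro z; have := hdom z; rw [hW] at this; exact this
          have h := abs_le_selfImproving_logWeight hψm hmem hN hm hB0 hCg0 hν₀ hdom' hB hx1 hx2 hx3 (hν₀le x)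
            (hgb x) (hfix x)
          rw [← hS, ← hm₂, ← he₀, ← hδ] at h
          rw [hW]
          refine h.trans (mul_le_mul_of_nonneg_right (add_le_add le_rfl (mul_le_mul_of_nonneg_left ?_ hδ0.le))
            (zero_le_one.trans (hW0 x)))
          calc 8 * (e₀ * (C4 * M8 * Cg + Cg)) = 8 * (e₀ * (C4 * M8 + 1)) * Cg := by ring
            _ ≤ Ec * Cg := mul_le_mul_of_nonneg_right (by rw [hEc]; exact le_max_left _ _) hCg0
            _ = E := hE.symm
  -- `N → ∞`
  intro v
  have h := le_mul_of_forall_le_mul_add_div (t := |ψ₀ v|) (C := Ec * Cg)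
    (w := (1 + ‖v‖ ^ 2) * (1 + Real.log (1 + ‖v‖ ^ 2))) (w' := (1 + ‖v‖ ^ 2) ^ 2) (fun N hN => key N hN v)
  calc |ψ₀ v| ≤ Ec * Cg * ((1 + ‖v‖ ^ 2) * (1 + Real.log (1 + ‖v‖ ^ 2))) := h
    _ = Ec * Cg * (1 + ‖v‖ ^ 2) * (1 + Real.log (1 + ‖v‖ ^ 2)) := by ring

end Summit.AtomisticToContinuum.HydrodynamicLimit.Theorems.ClampedCorrectorBirth

end
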